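import Literature.Geometry.DiscreteGeometry.DelsarteLinearProgrammingBound

/-!
# A 240-point kissing configuration in dimension 8 is a spherical design (moment form)

Framing: lottery ticket; floor = certified bounds/negative ranges. Venture `PackingBounds`
(cell `pub-packcert`), kissing family, sharp control d = 8, STRUCTURE half (design condition).

**Theorem (Bannai–Sloane 1981; Conway–Sloane Ch. 14).** If `C ⊂ S^{7}` has pairwise inner
products `≤ 1/2` and `|C| = 240`, then for every `k = 1, …, 6` the Gegenbauer moment vanishes:
`Σ_{x,y ∈ C} C_k^{(3)}(⟨x,y⟩) = 0` (so `C` is a spherical `6`-design; with antipodality a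
`7`-design — not shown here). Proof: the sharp Delsarte certificate of degree 6 has ALL Gegenbauer
coefficients `f_1, …, f_6` strictly positive, and complementary slackness
(`Literature.Geometry.DiscreteGeometry.DelsarteLP.sum_sum_gegenbauerSum_eq_zero_of_card_mul_eq_coord`)
forces each weighted moment to vanish when `|C| f_0 = f(1)` (here `240 · f_0 = f(1)` exactly).

## References
* E. Bannai, N. J. A. Sloane, Canad. J. Math. 33 (1981) 437–449 (= Conway–Sloane, *SPLAG*, Ch. 14). [`ConwaySloane1999`]
-/

namespace Summit.Ventures.PackingBounds.Kissing

open Finset Literature.Analysis.SpecialFunctions Literature.Geometry.DiscreteGeometry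

/-- **Design property of a 240-point kissing configuration in `ℝ^8`**: for `1 ≤ k ≤ 6`,
`Σ_{x,y ∈ C} C_k^{(3)}(⟨x,y⟩) = 0` (`C_k = gegenbauerSum 3 k`). Bannai–Sloane 1981, first step.
[cite: ConwaySloane1999, Ch. 14 §§2–3] -/
theorem kissing_dim8_moments_of_card_eq_240 (C : Finset (EuclideanSpace ℝ (Fin 8)))
    (h1 : ∀ x ∈ C, ‖x‖ = 1) (h2 : ∀ x ∈ C, ∀ y ∈ C, x ≠ y → inner ℝ x y ≤ 1 / 2)
    (hcard : C.card = 240) {k : ℕ} (hk1 : 1 ≤ k) (hk2 : k ≤ 6) :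
    ∑ x ∈ C, ∑ y ∈ C, gegenbauerSum (3 : ℝ) k (inner ℝ x y) = 0 := by
  classical
  have hpoly : ∀ t : ℝ, ∑ k ∈ range (6 + 1),
      (fun k => match k with
      | 0 => 3 / 320 | 1 => 1 / 80 | 2 => 5 / 448 | 3 => 39 / 4480 | 4 => 19 / 3840 | 5 => 1 / 448
      | 6 => 1 / 1792 | _ => 0) k * gegenbauerSum (3 : ℝ) k t =
      (t + 1) * ((t + 1 / 2) ^ 2 * t ^ 2) * (t - 1 / 2) := by
    intro t
    simp [Finset.sum_range_succ, gegenbauerSum, gegenbauerCoeff, Finset.prod_range_succ,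
      Nat.factorial]
    ring
  have hinner : ∀ a b : EuclideanSpace ℝ (Fin 8), inner ℝ a b = ∑ j, a j * b j := fun a b => by
    simp [PiLp.inner_apply, mul_comm]
  have key := DelsarteLP.sum_sum_gegenbauerSum_eq_zero_of_card_mul_eq_coord (n := 8) (μ := 3)
    (by norm_num) (by norm_num) 6
    (fun k => match k with
      | 0 => 3 / 320 | 1 => 1 / 80 | 2 => 5 / 448 | 3 => 39 / 4480 | 4 => 19 / 3840 | 5 => 1 / 448
      | 6 => 1 / 1792 | _ => 0)
    ?_ (1 / 2) ?_ (ι := C) (fun a j => (a : EuclideanSpace ℝ (Fin 8)) j) ?_ ?_ ?_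
    (k := k) (Finset.mem_range.2 (by omega)) hk1 ?_
  · -- rewrite the sum over the subtype as a sum over the Finset
    have hco : ∑ x ∈ C, ∑ y ∈ C, gegenbauerSum (3 : ℝ) k (inner ℝ x y) =
        ∑ a : C, ∑ b : C, gegenbauerSum (3 : ℝ) k
          (∑ j, (a : EuclideanSpace ℝ (Fin 8)) j * (b : EuclideanSpace ℝ (Fin 8)) j) := by
      rw [← Finset.sum_coe_sort C]
      refine Finset.sum_congr rfl fun a _ => ?_
      rw [← Finset.sum_coe_sort C]
      refine Finset.sum_congr rfl fun b _ => ?_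
      rw [hinner]
    rw [hco]
    exact key
  · intro k
    split <;> norm_num
  · intro t ht1 ht2
    rw [hpoly]
    exact mul_nonpos_of_nonneg_of_nonpos (mul_nonneg (by linarith) (by positivity)) (by linarith)
  · intro a
    rw [← EuclideanSpace.real_norm_sq_eq, h1 a a.2, one_pow]
  · intro a b hab
    have hne : (a : EuclideanSpace ℝ (Fin 8)) ≠ b := fun h => hab (Subtype.ext h)
    have h := h2 a a.2 b b.2 hne
    rwa [hinner] at h
  · rw [Fintype.card_coe, hcard]
    norm_num [Finset.sum_range_succ, gegenbauerSum, gegenbauerCoeff, Finset.prod_range_succ,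
      Nat.factorial]
  · interval_cases k <;> norm_num

end Summit.Ventures.PackingBounds.Kissing
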